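import Mathlib
import Literature.Analysis.FluidPDE.VectorCalculus
import Summits.NavierStokesRegularity.NavierStokesRegularity.Theorems.FilamentSkeletonRssClause13RAdjointEnergy

/-!
# Clause 13-R, STUB R at MODEL level: no annihilating density that is only PIECEWISE regular across the waist
# (crux `Clause13RNearStraightL`, stmt-NavierStokesRegularity-23612; line `rate_bordered_split`, STUB R `stub_rateRow13RFlat`)

Route `FilamentSkeletonRss`, Variant A1R.  The landed energy identity `…Clause13RAdjointEnergy.model_adjoint_no_regular_annihilator` (hand fsrs-16-g0)
shows that the MODEL adjoint equation of the rate row (one straight axis, slip `w` vanishing once in the ball `S = [a,b]`, `w′ > −1`),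

  `cst • (m σ • (φ σ × d) − ∫_{τ∈S} k(τ−σ) • (φ τ × d) dτ) + ½ φ σ + α e × φ σ + w′ σ φ σ + w σ φ′ σ = 0`   (σ ∈ S),

has no nonzero solution `φ` that is `C¹` ON THE WHOLE BALL.  Because the transport coefficient `w` vanishes at the waist station `c ∈ (a,b)`
(the stagnation point of the slip), that hypothesis leaves one loophole for an annihilating DENSITY of the linearised normal-velocity map on clamped
test fields: a weight that solves the equation on each side of the waist but is discontinuous (jumps or kinks) AT the waist — `w φ` is continuous
there whatever the one-sided values of `φ` are, so such a weight is a legitimate distributional candidate.  THIS FILE CLOSES THAT LOOPHOLE: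

* `setIntegral_cross_nonlocal_cancel` — the two CROSS pairings of the nonlocal term between the half-balls `[a,c]` and `[c,b]` cancel
  (even kernel, alternating triple product, Fubini on the rectangle `[a,c] × [c,b]`);
* `model_adjoint_no_piecewise_annihilator` — if `φ₁ ∈ C¹` solves the equation on `[a,c]` and `φ₂ ∈ C¹` solves it on `[c,b]`, the nonlocal term
  being that of the GLUED density (`∫_{[a,c]} k(τ−σ)•(φ₁ τ × d) + ∫_{[c,b]} k(τ−σ)•(φ₂ τ × d)`, which is the integral over `S` of the piecewise
  weight, the overlap `{c}` being null), with `w(a) ≤ 0 = w(c) ≤ w(b)` and `w′ ≥ −1 + 2ε` on `S`, then `φ₁ ≡ 0` on `[a,c]` and `φ₂ ≡ 0` on `[c,b]` —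
  NO CONDITION relating `φ₁(c)` and `φ₂(c)` is assumed.  Proof: the landed a-priori bound `model_adjoint_apriori` on each half-ball, with the
  other half's nonlocal contribution as the source (`w(c) = 0` makes the waist an admissible endpoint of both halves), summed; the sources cancel by
  the first lemma, leaving `ε(∫_a^c ‖φ₁‖² + ∫_c^b ‖φ₂‖²) ≤ 0`.

Planner-facing meaning (memo DIAG-23612-R-currency-leafhand19-g0.md §3): together with the waist indicial law (every nonzero LOCAL homogeneous
solution blows up like `|σ−c|^{−1−1/(2w′(c))}`, non-integrably), the `(C⁰)*`-cokernel of the model operator on clamped fields contains NO density part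
beyond the edge-sourced one — the rate-row information of 13-R is pure EDGE information, and an `L²`/`L^p` retype of the 13-R defect hypothesis would
make the rate conclusion false at model level.  [folklore] (energy method for transport + conservative nonlocal operator, applied piecewise).
Hand `leafhand-ns-filamentskeletonrs-19-g0` (LAND-ONLY); `--supports stmt-NavierStokesRegularity-23612` helper, def-free.  HONEST FRAMING: an identity
for the MODEL adjoint equation attached to a HYPOTHETICAL filament skeleton on the NEGATIVE side of a MODEL blow-up route; STUB R is NOT proved here
and nothing in this file bears on Navier–Stokes regularity or blow-up.
-/

noncomputable section

open MeasureTheory Filter Topology Set intervalIntegral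
open scoped RealInnerProductSpace InnerProductSpace
open Literature.Analysis.FluidPDE
open Summit.NavierStokesRegularity.NavierStokesRegularity.Theorems.Clause13RAdjointEnergy
  (inner_cross_left_swap model_adjoint_apriori)

namespace Summit.NavierStokesRegularity.NavierStokesRegularity.Theorems.Clause13RAdjointPiecewise
set_option linter.dupNamespace false

/-! ## §1 The cross pairings of the nonlocal term between the two half-balls cancel -/

/-- Two-weight antisymmetry of the nonlocal pairing density: `k(τ−σ)⟪ψ τ × d, φ σ⟫ = −(k(σ−τ)⟪φ σ × d, ψ τ⟫)` for an even kernel. [folklore] -/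
theorem cross_density_antisymm {k : ℝ → ℝ} (hkev : ∀ s, k (-s) = k s) (φ ψ : ℝ → EuclideanSpace ℝ (Fin 3))
    (d : EuclideanSpace ℝ (Fin 3)) (σ τ : ℝ) :
    k (τ - σ) * ⟪cross (ψ τ) d, φ σ⟫ = -(k (σ - τ) * ⟪cross (φ σ) d, ψ τ⟫) := by
  have hk : k (τ - σ) = k (σ - τ) := by rw [← hkev (σ - τ), neg_sub]
  rw [hk, inner_cross_left_swap (ψ τ) (φ σ) d]
  ring

/-- Continuity of `τ ↦ φ τ × d` for a continuous weight. [folklore] -/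
theorem continuous_cross_left {φ : ℝ → EuclideanSpace ℝ (Fin 3)} (hφ : Continuous φ) (d : EuclideanSpace ℝ (Fin 3)) :
    Continuous fun τ => cross (φ τ) d := by
  have : Continuous fun τ => crossCLM (φ τ) d := (crossCLM.continuous₂).comp₂ hφ continuous_const
  simpa only [crossCLM_apply] using this

/-- The pairing `⟪∫_{τ∈[p,q]} k(τ−σ)•(ψ τ × d) dτ, φ σ⟫` as an inner integral of the scalar density. [folklore] -/
theorem inner_nonlocal_eq_integral {p q : ℝ} {k : ℝ → ℝ} (hk : Continuous k) {φ ψ : ℝ → EuclideanSpace ℝ (Fin 3)}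
    (hψ : Continuous ψ) (d : EuclideanSpace ℝ (Fin 3)) (σ : ℝ) :
    ⟪∫ τ in Icc p q, k (τ - σ) • cross (ψ τ) d, φ σ⟫ = ∫ τ in Icc p q, k (τ - σ) * ⟪cross (ψ τ) d, φ σ⟫ := by
  have hint : IntegrableOn (fun τ => k (τ - σ) • cross (ψ τ) d) (Icc p q) :=
    ((hk.comp (continuous_id.sub continuous_const)).smul (continuous_cross_left hψ d)).continuousOn.integrableOn_compact
      isCompact_Icc
  rw [real_inner_comm, ← integral_inner hint (φ σ)]
  refine integral_congr_ae (Eventually.of_forall fun τ => ?_)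
  simp only [inner_smul_right, real_inner_comm (φ σ)]

/-- **The cross pairings cancel.**  For a continuous even kernel `k` and continuous weights `φ₁` (on `[a,c]`) and `φ₂` (on `[c,b]`),
`∫_{σ∈[a,c]} ⟪∫_{τ∈[c,b]} k(τ−σ)•(φ₂ τ × d) dτ, φ₁ σ⟫ dσ + ∫_{σ∈[c,b]} ⟪∫_{τ∈[a,c]} k(τ−σ)•(φ₁ τ × d) dτ, φ₂ σ⟫ dσ = 0`:
the action of each half-ball's weight on the other is a conservative exchange. [folklore] -/
theorem setIntegral_cross_nonlocal_cancel {a c b : ℝ} {k : ℝ → ℝ} (hk : Continuous k) (hkev : ∀ s, k (-s) = k s)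
    {φ₁ φ₂ : ℝ → EuclideanSpace ℝ (Fin 3)} (hφ₁ : Continuous φ₁) (hφ₂ : Continuous φ₂) (d : EuclideanSpace ℝ (Fin 3)) :
    (∫ σ in Icc a c, ⟪∫ τ in Icc c b, k (τ - σ) • cross (φ₂ τ) d, φ₁ σ⟫)
      + (∫ σ in Icc c b, ⟪∫ τ in Icc a c, k (τ - σ) • cross (φ₁ τ) d, φ₂ σ⟫) = 0 := by
  -- the two scalar densities
  set F : ℝ → ℝ → ℝ := fun σ τ => k (τ - σ) * ⟪cross (φ₂ τ) d, φ₁ σ⟫ with hF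
  set G : ℝ → ℝ → ℝ := fun σ τ => k (τ - σ) * ⟪cross (φ₁ τ) d, φ₂ σ⟫ with hG
  have hFc : Continuous (Function.uncurry F) := by
    have h1 : Continuous fun p : ℝ × ℝ => k (p.2 - p.1) := hk.comp (continuous_snd.sub continuous_fst)
    have h2 : Continuous fun p : ℝ × ℝ => ⟪cross (φ₂ p.2) d, φ₁ p.1⟫ :=
      ((continuous_cross_left hφ₂ d).comp continuous_snd).inner (hφ₁.comp continuous_fst)
    exact h1.mul h2
  have hGc : Continuous (Function.uncurry G) := by
    have h1 : Continuous fun p : ℝ × ℝ => k (p.2 - p.1) := hk.comp (continuous_snd.sub continuous_fst)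
    have h2 : Continuous fun p : ℝ × ℝ => ⟪cross (φ₁ p.2) d, φ₂ p.1⟫ :=
      ((continuous_cross_left hφ₁ d).comp continuous_snd).inner (hφ₂.comp continuous_fst)
    exact h1.mul h2
  -- rewrite both pairings as double integrals
  have hF1 : ∀ σ, ⟪∫ τ in Icc c b, k (τ - σ) • cross (φ₂ τ) d, φ₁ σ⟫ = ∫ τ in Icc c b, F σ τ := fun σ =>
    inner_nonlocal_eq_integral hk hφ₂ d σ
  have hG1 : ∀ σ, ⟪∫ τ in Icc a c, k (τ - σ) • cross (φ₁ τ) d, φ₂ σ⟫ = ∫ τ in Icc a c, G σ τ := fun σ =>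
    inner_nonlocal_eq_integral hk hφ₁ d σ
  simp_rw [hF1, hG1]
  -- Fubini on the rectangle `[c,b] × [a,c]` for `G`
  have hprodG : Integrable (Function.uncurry G) ((volume.restrict (Icc c b)).prod (volume.restrict (Icc a c))) := by
    rw [Measure.prod_restrict]
    exact hGc.continuousOn.integrableOn_compact (isCompact_Icc.prod isCompact_Icc)
  have hswap : ∫ σ in Icc c b, ∫ τ in Icc a c, G σ τ = ∫ τ in Icc a c, ∫ σ in Icc c b, G σ τ :=
    integral_integral_swap hprodG
  -- pointwise antisymmetry `G σ τ = -F τ σ`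
  have hanti : ∫ τ in Icc a c, ∫ σ in Icc c b, G σ τ = -∫ τ in Icc a c, ∫ σ in Icc c b, F τ σ := by
    rw [← MeasureTheory.integral_neg]
    refine integral_congr_ae (Eventually.of_forall fun τ => ?_)
    simp only
    rw [← MeasureTheory.integral_neg]
    refine integral_congr_ae (Eventually.of_forall fun σ => ?_)
    simp only [hF, hG]
    have h := cross_density_antisymm hkev φ₂ φ₁ d σ τ
    -- `h : k (τ - σ) * ⟪φ₁ τ × d, φ₂ σ⟫ = -(k (σ - τ) * ⟪φ₂ σ × d, φ₁ τ⟫)`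
    exact h
  rw [hswap, hanti]
  ring

/-! ## §2 No annihilating density that is only piecewise `C¹` across the waist -/

/-- Algebra of the split: `cst • (X − (A + B)) + R = 0` gives `cst • (X − A) + R = cst • B`. [folklore] -/
theorem split_source {V : Type*} [AddCommGroup V] [Module ℝ V] (cst : ℝ) (X A B R : V)
    (h : cst • (X - (A + B)) + R = 0) : cst • (X - A) + R = cst • B := by
  have : cst • (X - (A + B)) = cst • (X - A) - cst • B := by
    rw [← smul_sub]; congr 1; abel
  rw [this] at h
  have h2 := sub_eq_zero.mp (by rwa [sub_add_eq_add_sub] at h)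
  exact h2

/-- **NO PIECEWISE-REGULAR ANNIHILATING DENSITY for the model adjoint equation of the rate row.**  Ball `S = [a,b]`, waist `c` with
`a < c < b`; slip `w ∈ C¹` with `w(a) ≤ 0`, `w(c) = 0`, `0 ≤ w(b)` and `w′ ≥ −1 + 2ε` on `S` (`ε > 0`); continuous even kernel `k`, any scalar
weight `m`, constants `cst, α`, vectors `d, e`.  Let `φ₁, φ₂ ∈ C¹(ℝ)` (only their values on `[a,c]`, resp. `[c,b]`, matter) solve the adjoint
equation on `[a,c]`, resp. `[c,b]`, with the nonlocal term of the GLUED weight,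
`N σ = ∫_{τ∈[a,c]} k(τ−σ)•(φ₁ τ × d) dτ + ∫_{τ∈[c,b]} k(τ−σ)•(φ₂ τ × d) dτ`:
  `cst • (m σ • (φᵢ σ × d) − N σ) + ½ φᵢ σ + α e × φᵢ σ + w′ σ φᵢ σ + w σ φᵢ′ σ = 0`  (`i = 1` on `[a,c]`, `i = 2` on `[c,b]`).
Then `φ₁ ≡ 0` on `[a,c]` and `φ₂ ≡ 0` on `[c,b]` — with NO matching condition at the waist (the one-sided values `φ₁(c)`, `φ₂(c)` are free).
The `C¹`-on-`S` case is `…Clause13RAdjointEnergy.model_adjoint_no_regular_annihilator` (`φ₁ = φ₂`). [folklore] -/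
theorem model_adjoint_no_piecewise_annihilator {a c b cst α ε : ℝ} (hac : a < c) (hcb : c < b) (hε : 0 < ε)
    {k m w w' : ℝ → ℝ} {φ₁ φ₁' φ₂ φ₂' : ℝ → EuclideanSpace ℝ (Fin 3)} {d e : EuclideanSpace ℝ (Fin 3)}
    (hk : Continuous k) (hkev : ∀ s, k (-s) = k s)
    (hw : ∀ σ, HasDerivAt w (w' σ) σ) (hw'c : Continuous w')
    (hφ₁ : ∀ σ, HasDerivAt φ₁ (φ₁' σ) σ) (hφ₁'c : Continuous φ₁')
    (hφ₂ : ∀ σ, HasDerivAt φ₂ (φ₂' σ) σ) (hφ₂'c : Continuous φ₂')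
    (hwa : w a ≤ 0) (hwc : w c = 0) (hwb : 0 ≤ w b) (hgrowth : ∀ σ ∈ Icc a b, -1 + 2 * ε ≤ w' σ)
    (heq₁ : ∀ σ ∈ Icc a c,
      cst • (m σ • cross (φ₁ σ) d
          - ((∫ τ in Icc a c, k (τ - σ) • cross (φ₁ τ) d) + ∫ τ in Icc c b, k (τ - σ) • cross (φ₂ τ) d))
        + (1 / 2 : ℝ) • φ₁ σ + α • cross e (φ₁ σ) + w' σ • φ₁ σ + w σ • φ₁' σ = 0)
    (heq₂ : ∀ σ ∈ Icc c b,
      cst • (m σ • cross (φ₂ σ) d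
          - ((∫ τ in Icc a c, k (τ - σ) • cross (φ₁ τ) d) + ∫ τ in Icc c b, k (τ - σ) • cross (φ₂ τ) d))
        + (1 / 2 : ℝ) • φ₂ σ + α • cross e (φ₂ σ) + w' σ • φ₂ σ + w σ • φ₂' σ = 0) :
    (∀ σ ∈ Icc a c, φ₁ σ = 0) ∧ (∀ σ ∈ Icc c b, φ₂ σ = 0) := by
  have hφ₁c : Continuous φ₁ := continuous_iff_continuousAt.2 fun σ => (hφ₁ σ).continuousAt
  have hφ₂c : Continuous φ₂ := continuous_iff_continuousAt.2 fun σ => (hφ₂ σ).continuousAt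
  -- the two zeroth-order parts and their coercivity along the solutions
  have hcrossc : ∀ {φ : ℝ → EuclideanSpace ℝ (Fin 3)}, Continuous φ → Continuous fun σ => cross e (φ σ) := by
    intro φ hφ
    have : Continuous fun τ => crossCLM e (φ τ) := (crossCLM.continuous₂).comp₂ continuous_const hφ
    simpa only [crossCLM_apply] using this
  have h11 : Continuous fun σ => (1 / 2 : ℝ) • φ₁ σ := hφ₁c.const_smul (1 / 2 : ℝ)
  have h12 : Continuous fun σ => α • cross e (φ₁ σ) := (hcrossc hφ₁c).const_smul α
  have hg₁ : Continuous fun σ => (1 / 2 : ℝ) • φ₁ σ + α • cross e (φ₁ σ) := h11.add h12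
  have h21 : Continuous fun σ => (1 / 2 : ℝ) • φ₂ σ := hφ₂c.const_smul (1 / 2 : ℝ)
  have h22 : Continuous fun σ => α • cross e (φ₂ σ) := (hcrossc hφ₂c).const_smul α
  have hg₂ : Continuous fun σ => (1 / 2 : ℝ) • φ₂ σ + α • cross e (φ₂ σ) := h21.add h22
  have he0 : ∀ x : EuclideanSpace ℝ (Fin 3), ⟪cross e x, x⟫ = 0 := by
    intro x
    simp only [cross, cross_apply, PiLp.inner_apply, RCLike.inner_apply, conj_trivial, Fin.sum_univ_three,
      Matrix.cons_val_zero, Matrix.cons_val_one, Matrix.cons_val_two, Matrix.head_cons, Matrix.tail_cons]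
    ring
  have hcoer : ∀ (φ : ℝ → EuclideanSpace ℝ (Fin 3)) (σ : ℝ), σ ∈ Icc a b →
      ε * ‖φ σ‖ ^ 2 ≤ ⟪(1 / 2 : ℝ) • φ σ + α • cross e (φ σ), φ σ⟫ + 1 / 2 * w' σ * ‖φ σ‖ ^ 2 := by
    intro φ σ hσ
    simp only [inner_add_left, inner_smul_left, conj_trivial, he0, real_inner_self_eq_norm_sq, mul_zero, add_zero]
    have h1 := hgrowth σ hσ
    have h2 : 0 ≤ ‖φ σ‖ ^ 2 := sq_nonneg _
    nlinarith
  -- the half-ball equations in sourced form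
  have heq₁' : ∀ σ ∈ Icc a c,
      cst • (m σ • cross (φ₁ σ) d - ∫ τ in Icc a c, k (τ - σ) • cross (φ₁ τ) d)
        + ((1 / 2 : ℝ) • φ₁ σ + α • cross e (φ₁ σ)) + w' σ • φ₁ σ + w σ • φ₁' σ
        = cst • ∫ τ in Icc c b, k (τ - σ) • cross (φ₂ τ) d := by
    intro σ hσ
    have h := heq₁ σ hσ
    rw [add_assoc (cst • _) ((1 / 2 : ℝ) • φ₁ σ), add_assoc (cst • _), add_assoc (cst • _)] at h
    have h' := split_source cst _ _ _ _ h
    simpa only [add_assoc] using h'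
  have heq₂' : ∀ σ ∈ Icc c b,
      cst • (m σ • cross (φ₂ σ) d - ∫ τ in Icc c b, k (τ - σ) • cross (φ₂ τ) d)
        + ((1 / 2 : ℝ) • φ₂ σ + α • cross e (φ₂ σ)) + w' σ • φ₂ σ + w σ • φ₂' σ
        = cst • ∫ τ in Icc a c, k (τ - σ) • cross (φ₁ τ) d := by
    intro σ hσ
    have h := heq₂ σ hσ
    have hcomm : (∫ τ in Icc a c, k (τ - σ) • cross (φ₁ τ) d) + (∫ τ in Icc c b, k (τ - σ) • cross (φ₂ τ) d)
        = (∫ τ in Icc c b, k (τ - σ) • cross (φ₂ τ) d) + ∫ τ in Icc a c, k (τ - σ) • cross (φ₁ τ) d := add_comm _ _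
    rw [hcomm] at h
    rw [add_assoc (cst • _) ((1 / 2 : ℝ) • φ₂ σ), add_assoc (cst • _), add_assoc (cst • _)] at h
    have h' := split_source cst _ _ _ _ h
    simpa only [add_assoc] using h'
  -- a-priori bounds on each half-ball (the waist `c`, where `w = 0`, is an admissible endpoint of both)
  have hA₁ := model_adjoint_apriori (cst := cst) (m := m) (d := d) hac.le hk hkev hw hφ₁ hw'c hφ₁'c hg₁ hwa (le_of_eq hwc.symm)
    (fun σ hσ => hcoer φ₁ σ ⟨hσ.1, hσ.2.trans hcb.le⟩) heq₁'
  have hA₂ := model_adjoint_apriori (cst := cst) (m := m) (d := d) hcb.le hk hkev hw hφ₂ hw'c hφ₂'c hg₂ (le_of_eq hwc) hwb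
    (fun σ hσ => hcoer φ₂ σ ⟨hac.le.trans hσ.1, hσ.2⟩) heq₂'
  -- the sources cancel in the sum
  have hsum : (∫ σ in a..c, ⟪cst • ∫ τ in Icc c b, k (τ - σ) • cross (φ₂ τ) d, φ₁ σ⟫)
      + (∫ σ in c..b, ⟪cst • ∫ τ in Icc a c, k (τ - σ) • cross (φ₁ τ) d, φ₂ σ⟫) = 0 := by
    simp_rw [inner_smul_left, conj_trivial]
    rw [intervalIntegral.integral_const_mul, intervalIntegral.integral_const_mul, ← mul_add,
      integral_of_le hac.le, integral_of_le hcb.le, ← integral_Icc_eq_integral_Ioc, ← integral_Icc_eq_integral_Ioc,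
      setIntegral_cross_nonlocal_cancel hk hkev hφ₁c hφ₂c d, mul_zero]
  have hI₁ : 0 ≤ ∫ σ in a..c, ‖φ₁ σ‖ ^ 2 := intervalIntegral.integral_nonneg hac.le fun σ _ => sq_nonneg _
  have hI₂ : 0 ≤ ∫ σ in c..b, ‖φ₂ σ‖ ^ 2 := intervalIntegral.integral_nonneg hcb.le fun σ _ => sq_nonneg _
  have hz : ε * (∫ σ in a..c, ‖φ₁ σ‖ ^ 2) + ε * (∫ σ in c..b, ‖φ₂ σ‖ ^ 2) ≤ 0 := by linarith
  have hz₁ : ∫ σ in a..c, ‖φ₁ σ‖ ^ 2 = 0 := by nlinarith [mul_nonneg hε.le hI₁, mul_nonneg hε.le hI₂]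
  have hz₂ : ∫ σ in c..b, ‖φ₂ σ‖ ^ 2 = 0 := by nlinarith [mul_nonneg hε.le hI₁, mul_nonneg hε.le hI₂]
  -- positivity of the integral of a continuous nonnegative function with a nonzero value
  have key : ∀ {p q : ℝ} (hpq : p < q) {φ : ℝ → EuclideanSpace ℝ (Fin 3)} (hφ : Continuous φ)
      (hz : ∫ σ in p..q, ‖φ σ‖ ^ 2 = 0), ∀ σ ∈ Icc p q, φ σ = 0 := by
    intro p q hpq φ hφ hz σ hσ
    by_contra hne
    have hpos : 0 < ‖φ σ‖ ^ 2 := by positivity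
    have hcont2 : Continuous fun σ => ‖φ σ‖ ^ 2 := hφ.norm.pow 2
    have hlt : (∫ x in p..q, (fun _ => (0 : ℝ)) x) < ∫ x in p..q, ‖φ x‖ ^ 2 :=
      intervalIntegral.integral_lt_integral_of_continuousOn_of_le_of_exists_lt hpq continuousOn_const hcont2.continuousOn
        (fun x _ => sq_nonneg _) ⟨σ, hσ, hpos⟩
    simp only [intervalIntegral.integral_zero] at hlt
    linarith
  exact ⟨key hac hφ₁c hz₁, key hcb hφ₂c hz₂⟩

end Summit.NavierStokesRegularity.NavierStokesRegularity.Theorems.Clause13RAdjointPiecewise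

end
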